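import Summits.NavierStokesRegularity.FluidComputer.ForcedClassicalContinuation
import Summits.NavierStokesRegularity.FluidComputer.ForcedContinuationHalfOpen
import Literature.Analysis.FluidPDE.TaoH1LocalExistenceForcedHolds
import HarnessLib

/-!
# Forced classical continuation on `ℝ³` — UNCONDITIONAL: the restart loop fed with the tree's
# forced Fourier–Picard engine

Cell `ns-blowup`, seat `ns-blowup-ecbridge-1` (g6). LABEL: E–C typing + kernel analysis. WHAT THIS IS
NOT: not NS evidence — continuation / blow-up-criterion theorems for GIVEN classical solutions of the
forced Navier–Stokes system; no flow, stage, tower or blow-up is constructed or asserted.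

`ForcedClassicalContinuation.lean` (p432584) and `ForcedContinuationHalfOpen.lean` (p434537) proved
the forced continuation package MODULO the named fact
`Literature.Analysis.FluidPDE.tao2011_smooth_local_existence_forced` (Tao 2013, Thm. 5.4 (ii)+(iv)
WITH forcing). That fact is now the THEOREM
`Literature.Analysis.FluidPDE.tao2011_smooth_local_existence_forced_holds`
(`Literature/Analysis/FluidPDE/TaoH1LocalExistenceForcedHolds.lean`, p440532: forced Fourier–Picard
existence + Plancherel transfer + classical half + raw-force gauge, all in the tree). This file
records the hypothesis-free forms (same binders minus `hF`, same conclusions; new names because the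
gate reserves `X_holds` for closed discharges):

* `ForcedContinuation.exists_continuation_of_bounded` — a classical finite-energy
  solution with BOUNDED velocity on a closed slab `[0, τ]`, Clay force, Schwartz datum, `ν > 0`,
  continues classically (velocity AND pressure agreeing on `[0, τ]`) to some `[0, T']`, `T' > τ`;
* `ForcedContinuation.exists_extension_of_bounded_Ico`,
  `ForcedContinuation.hasSmoothExtensionPast_of_velocity_bounded` — the half-open slab forms;
* **`ForcedContinuation.velocity_unbounded_of_isMaximal`** — the `L^∞` BLOW-UP CRITERION WITH A
  CLAY FORCE: a maximal classical solution on `[0, T)` with Schwartz datum, Clay force and energy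
  bounded on `[0, T)` has unbounded velocity on `[0, T) × ℝ³` (Leray / Lemarié-Rieusset Thm. 11.2 at
  `r = ∞`, classical Clay-class form) — NO named fact;
* `Stage.exists_continuation_past` — every stage of any schedule / rates / margins at any
  viscosity `ν > 0` crosses the end of its slab under the design force.

References: T. Tao, Anal. PDE 6 (2013), Thm. 5.4 [cite: Tao2011, Thm. 5.4 (ii)+(iv)];
P. G. Lemarié-Rieusset, *The Navier–Stokes Problem in the 21st Century* (CRC 2016), Thm. 11.2
(11.11) [cite: LemarieRieusset2016, Thm. 11.2 (11.11)]; J. T. Beale, T. Kato, A. Majda, Comm. Math.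
Phys. 94 (1984), §1 [cite: BealeKatoMajda1984, §1]; S. Palasek, arXiv:2605.13827 §4
[cite: Palasek2026ElementaryModel, §4].
-/

noncomputable section

open Set MeasureTheory
open scoped ENNReal

namespace Summit.NavierStokesRegularity.FluidComputer.PalasekTowerClayBridge

open Literature.Analysis.FluidPDE

namespace ForcedContinuation

variable {ν τ M : ℝ} {f u : ℝ → EuclideanSpace ℝ (Fin 3) → EuclideanSpace ℝ (Fin 3)}
  {p : ℝ → EuclideanSpace ℝ (Fin 3) → ℝ}

/-- **Crossing the end of a slab (forced), unconditionally**: a classical solution `(u, p)` of the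
Navier–Stokes system with viscosity `ν > 0` and a Clay-class force `f` on the closed slab
`[0, τ] × ℝ³`, `τ > 0`, with finite energy, bounded velocity and a Schwartz datum `u(0)`, has a
classical finite-energy continuation with the same force to a slab `[0, T']`, `T' > τ`, agreeing with
`(u, p)` on `[0, τ]`. [cite: Tao2011, Thm. 5.4 (ii)+(iv)] [cite: LemarieRieusset2016, Thm. 11.2 (11.11)] -/
theorem exists_continuation_of_bounded (hν : 0 < ν) (hτ : 0 < τ)
    (hs : IsSmoothOnHalfSpace f) (hd : HasRapidSpaceTimeDecay f)
    (hu : IsClassicalNSSolutionOn (Icc 0 τ) ν f u p)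
    (hE : ∃ C : ℝ≥0∞, C < ⊤ ∧ ∀ t ∈ Icc 0 τ, ∫⁻ x, ‖u t x‖ₑ ^ 2 ≤ C)
    (hM : ∀ t ∈ Icc 0 τ, ∀ x, ‖u t x‖ ≤ M) (h0 : HasRapidSpatialDecay (u 0)) :
    ∃ T' : ℝ, τ < T' ∧
      ∃ (U : ℝ → EuclideanSpace ℝ (Fin 3) → EuclideanSpace ℝ (Fin 3))
        (P : ℝ → EuclideanSpace ℝ (Fin 3) → ℝ),
        IsClassicalNSSolutionOn (Icc 0 T') ν f U P ∧
        (∀ t ∈ Icc 0 τ, U t = u t ∧ P t = p t) ∧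
        (∃ C : ℝ≥0∞, C < ⊤ ∧ ∀ t ∈ Icc 0 T', ∫⁻ x, ‖U t x‖ₑ ^ 2 ≤ C) :=
  exists_forced_continuation_of_bounded tao2011_smooth_local_existence_forced_holds hν hτ hs hd hu
    hE hM h0

/-- **Extension past a half-open slab (forced, bounded), unconditionally**: a classical solution on
`[0, τ) × ℝ³` (`ν > 0`, Clay force) with energy and velocity bounded uniformly on `[0, τ)` and Schwartz
datum has a classical finite-energy extension to a CLOSED slab `[0, T']`, `T' > τ`, with the same
velocity on `[0, τ)`. [cite: Tao2011, Thm. 5.4 (ii)+(iv)] [cite: LemarieRieusset2016, Thm. 11.2 (11.11)] -/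
theorem exists_extension_of_bounded_Ico (hν : 0 < ν) (hτ : 0 < τ)
    (hs : IsSmoothOnHalfSpace f) (hd : HasRapidSpaceTimeDecay f)
    (hu : IsClassicalNSSolutionOn (Ico 0 τ) ν f u p)
    (hE : ∃ C : ℝ≥0∞, C < ⊤ ∧ ∀ t ∈ Ico 0 τ, ∫⁻ x, ‖u t x‖ₑ ^ 2 ≤ C)
    (hM : ∀ t ∈ Ico 0 τ, ∀ x, ‖u t x‖ ≤ M) (h0 : HasRapidSpatialDecay (u 0)) :
    ∃ T' : ℝ, τ < T' ∧
      ∃ (U : ℝ → EuclideanSpace ℝ (Fin 3) → EuclideanSpace ℝ (Fin 3))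
        (P : ℝ → EuclideanSpace ℝ (Fin 3) → ℝ),
        IsClassicalNSSolutionOn (Icc 0 T') ν f U P ∧
        (∀ t ∈ Ico 0 τ, U t = u t) ∧
        (∃ C : ℝ≥0∞, C < ⊤ ∧ ∀ t ∈ Icc 0 T', ∫⁻ x, ‖U t x‖ₑ ^ 2 ≤ C) :=
  exists_forced_extension_of_bounded_Ico tao2011_smooth_local_existence_forced_holds hν hτ hs hd hu
    hE hM h0

/-- **`HasSmoothExtensionPast` for bounded Clay-class solutions of the forced system, unconditionally.**
[cite: Tao2011, Thm. 5.4 (ii)+(iv)] -/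
theorem hasSmoothExtensionPast_of_velocity_bounded (hν : 0 < ν) (hτ : 0 < τ)
    (hs : IsSmoothOnHalfSpace f) (hd : HasRapidSpaceTimeDecay f)
    (hu : IsClassicalNSSolutionOn (Ico 0 τ) ν f u p)
    (hE : ∃ C : ℝ≥0∞, C < ⊤ ∧ ∀ t ∈ Ico 0 τ, ∫⁻ x, ‖u t x‖ₑ ^ 2 ≤ C)
    (hM : ∀ t ∈ Ico 0 τ, ∀ x, ‖u t x‖ ≤ M) (h0 : HasRapidSpatialDecay (u 0)) :
    HasSmoothExtensionPast ν f u τ :=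
  hasSmoothExtensionPast_of_bounded tao2011_smooth_local_existence_forced_holds hν hτ hs hd hu hE hM h0

/-- **The `L^∞` blow-up criterion WITH a Clay force — UNCONDITIONAL**: a MAXIMAL classical solution
on `[0, T)` (no classical extension past `T`) with viscosity `ν > 0`, Schwartz datum, Clay-class force
and energy bounded on `[0, T)` has unbounded velocity on `[0, T) × ℝ³`: for every `M` some `(t, x)`
with `t < T` and `M < ‖u(t, x)‖` (Leray's criterion; Lemarié-Rieusset 2016, Thm. 11.2 at `r = ∞`,
classical Clay-class form). [cite: LemarieRieusset2016, Thm. 11.2 (11.11)] [cite: BealeKatoMajda1984, §1] -/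
theorem velocity_unbounded_of_isMaximal {T : ℝ} (hν : 0 < ν) (hT : 0 < T)
    (hs : IsSmoothOnHalfSpace f) (hd : HasRapidSpaceTimeDecay f)
    (hmax : IsMaximalSmoothSolution ν f u p T)
    (hE : ∃ C : ℝ≥0∞, C < ⊤ ∧ ∀ t ∈ Ico 0 T, ∫⁻ x, ‖u t x‖ₑ ^ 2 ≤ C)
    (h0 : HasRapidSpatialDecay (u 0)) :
    ∀ M : ℝ, ∃ t ∈ Ico 0 T, ∃ x, M < ‖u t x‖ :=
  velocity_unbounded_of_maximal tao2011_smooth_local_existence_forced_holds hν hT hs hd hmax hE h0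

/-- **Contrapositive packaging**: a classical solution on `[0, T)` with `ν > 0`, Schwartz datum, Clay
force, energy AND velocity bounded on `[0, T)` is NOT maximal — it extends classically past `T`.
[cite: LemarieRieusset2016, Thm. 11.2 (11.11)] -/
theorem not_isMaximalSmoothSolution_of_bounded {T : ℝ} (hν : 0 < ν) (hT : 0 < T)
    (hs : IsSmoothOnHalfSpace f) (hd : HasRapidSpaceTimeDecay f)
    (hu : IsClassicalNSSolutionOn (Ico 0 T) ν f u p)
    (hE : ∃ C : ℝ≥0∞, C < ⊤ ∧ ∀ t ∈ Ico 0 T, ∫⁻ x, ‖u t x‖ₑ ^ 2 ≤ C)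
    (hM : ∀ t ∈ Ico 0 T, ∀ x, ‖u t x‖ ≤ M) (h0 : HasRapidSpatialDecay (u 0)) :
    ¬ IsMaximalSmoothSolution ν f u p T := fun hmax =>
  hmax.2 (hasSmoothExtensionPast_of_velocity_bounded hν hT hs hd hu hE hM h0)

end ForcedContinuation

namespace Stage

variable {ν : ℝ} {R : TowerRates} {S : Schedule R} {m : Margins R} {k : ℕ}

/-- **Every stage continues under the design force past its slab, unconditionally**: a stage at
level `k` of ANY schedule on ANY rates with ANY margins, at viscosity `ν > 0`, has a classical
finite-energy continuation with the schedule's force to some `[0, T']`, `T' > τ k`, velocity AND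
pressure agreeing on `[0, τ k]`. [cite: Tao2011, Thm. 5.4 (ii)+(iv)] [cite: Palasek2026ElementaryModel, §4] -/
theorem exists_continuation_past (hν : 0 < ν) (s : Stage ν R S m k) :
    ∃ T' : ℝ, S.τ k < T' ∧
      ∃ (U : ℝ → EuclideanSpace ℝ (Fin 3) → EuclideanSpace ℝ (Fin 3))
        (P : ℝ → EuclideanSpace ℝ (Fin 3) → ℝ),
        IsClassicalNSSolutionOn (Icc 0 T') ν S.f U P ∧
        (∀ t ∈ Icc 0 (S.τ k), U t = s.u t ∧ P t = s.p t) ∧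
        (∃ C : ℝ≥0∞, C < ⊤ ∧ ∀ t ∈ Icc 0 T', ∫⁻ x, ‖U t x‖ₑ ^ 2 ≤ C) :=
  s.exists_forced_continuation tao2011_smooth_local_existence_forced_holds hν

end Stage

end Summit.NavierStokesRegularity.FluidComputer.PalasekTowerClayBridge
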